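import Mathlib.MeasureTheory.Measure.Hausdorff
import Mathlib.Topology.MetricSpace.HausdorffDimension
import Mathlib.Analysis.SpecialFunctions.Pow.NNReal
import Mathlib.Analysis.SpecificLimits.Basic
import Mathlib.Analysis.Complex.ReImTopology
import Mathlib.MeasureTheory.Integral.Lebesgue.Countable
import Mathlib.MeasureTheory.Constructions.BorelSpace.Complex
import HarnessLib

/-!
# First-moment (covering) upper bound for the Hausdorff dimension of a random planar set

Topic: measure theory / Hausdorff measure and dimension. The standard "first moment method" for
**upper** bounds on the dimension of a random closed set `Γ(ω) ⊆ ℂ` (the counterpart of the energy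
method of `EnergyMethod.lean` for lower bounds): if every point `z` of a neighbourhood of the
rectangle `A = [x₁, x₂] × [y₁, y₂]` satisfies the **one-point estimate**

  `P[ dist(z, Γ) ≤ ε ] ≤ C ε^a`     for all `0 < ε ≤ δ`,

then for every `d > 2 - a` (`d > 0`), **almost surely `μH[d] (Γ ∩ A) = 0`**
(`ae_hausdorffMeasure_inter_reProdIm_eq_zero`), hence a.s. `dim_H (Γ ∩ A) ≤ d`; and if this holds
for all `d > d₀ ≥ 2 - a` then a.s. `dim_H(Γ ∩ A) ≤ d₀` (`ae_dimH_le_of_forall_lt`).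

Proof: cover `A` by the `≍ 4ⁿ` discs of radius `2 · 2⁻ⁿ` centred at the dyadic grid points of mesh
`2⁻ⁿ` (`dyPt`, `dyBox`, `exists_dist_dyPt_lt`); `Γ ∩ A` is covered by those discs whose centre is
within `2 · 2⁻ⁿ` of `Γ`, so `μH[d](Γ ∩ A) ≤ liminfₙ (4·2⁻ⁿ)^d Nₙ` (Mathlib
`hausdorffMeasure_le_liminf_sum`) with `Nₙ` the number of such centres; `E[Nₙ] ≤ C' 4ⁿ (2·2⁻ⁿ)^a`,
so `Σₙ (4·2⁻ⁿ)^d E[Nₙ] ≲ Σₙ 2^{n(2-a-d)} < ∞`, and a.s. `(4·2⁻ⁿ)^d Nₙ → 0`. No measurability of the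
events `{dist(z, Γ) ≤ ε}` is assumed: each is replaced by its measurable hull
(`MeasureTheory.toMeasurable`, same measure), and `P` of a non-measurable event means outer measure.

This is the covering step of Rohde–Schramm's proof that `dim_H` of the SLE_κ trace is a.s. at most
`1 + κ/8` (Ann. of Math. 161 (2005), Thm 8.1 ⇒ Cor 8.2: "`N ≤ #{z_j : dist(z_j, γ[0,∞)) < ε} ≤
100 N`", p. 914), isolated as an SLE-free lemma; cf. Lawler (2005), Lemma A.1 (the upper bound on
`dim_H` from covering numbers) and Beffara (2008), §1 (upper half of Prop. 1).

## Mathlib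

We USE `MeasureTheory.Measure.hausdorffMeasure_le_liminf_sum`, `dimH_le_of_hausdorffMeasure_ne_top`,
`MeasureTheory.toMeasurable` / `measure_toMeasurable`, `lintegral_finsetSum`, `lintegral_tsum`,
`ae_lt_top`, `ENNReal.tendsto_atTop_zero_of_tsum_ne_top`, `ENNReal.tsum_geometric`,
`Metric.ediam_eball_le`, `Complex.norm_le_abs_re_add_abs_im`, `Int.floor` / `Int.ceil`. Mathlib has
no ready-made "first moment ⇒ dimension" lemma (searched `dimH`, `hausdorffMeasure_le_liminf`).

## References

* S. Rohde, O. Schramm, *Basic properties of SLE*, Ann. of Math. 161 (2005), Thm 8.1, Cor 8.2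
  (p. 914).
* G. F. Lawler, *Conformally Invariant Processes in the Plane*, AMS (2005), Appendix A,
  Lemma A.1.
* V. Beffara, *The dimension of the SLE curves*, Ann. Probab. 36 (2008), §1.
* P. Mattila, *Geometry of Sets and Measures in Euclidean Spaces*, CUP (1995), §4–§5 (coverings
  and Hausdorff dimension).
-/

noncomputable section

open Set Filter Metric Function Complex
open _root_.MeasureTheory _root_.MeasureTheory.Measure
open scoped ENNReal NNReal Topology

namespace Literature.MeasureTheory.Hausdorff

/-! ### Dyadic grids in the plane -/

section Grid

/-- The dyadic mesh `2⁻ⁿ`. [folklore] -/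
def dyMesh (n : ℕ) : ℝ := ((2 : ℝ) ^ n)⁻¹

/-- The dyadic grid point `(j 2⁻ⁿ, k 2⁻ⁿ) ∈ ℂ` with index `p = (j, k)`. [folklore] -/
def dyPt (n : ℕ) (p : ℤ × ℤ) : ℂ := ⟨p.1 * dyMesh n, p.2 * dyMesh n⟩

/-- The finite set of grid indices serving the rectangle `[x₁, x₂] × [y₁, y₂]` at level `n`
(one spare row/column on each side). [folklore] -/
def dyBox (x₁ x₂ y₁ y₂ : ℝ) (n : ℕ) : Finset (ℤ × ℤ) :=
  Finset.Icc (⌊x₁ * 2 ^ n⌋ - 1) (⌈x₂ * 2 ^ n⌉ + 1) ×ˢ Finset.Icc (⌊y₁ * 2 ^ n⌋ - 1) (⌈y₂ * 2 ^ n⌉ + 1)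

/-- `2⁻ⁿ > 0`. [folklore] -/
theorem dyMesh_pos (n : ℕ) : 0 < dyMesh n := by unfold dyMesh; positivity

/-- `2ⁿ · 2⁻ⁿ = 1`. [folklore] -/
theorem two_pow_mul_dyMesh (n : ℕ) : (2 : ℝ) ^ n * dyMesh n = 1 := by
  unfold dyMesh; field_simp

/-- `2⁻ⁿ ≤ 1`. [folklore] -/
theorem dyMesh_le_one (n : ℕ) : dyMesh n ≤ 1 := by
  unfold dyMesh
  exact inv_le_one_of_one_le₀ (one_le_pow₀ (by norm_num))

/-- The mesh is non-increasing. [folklore] -/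
theorem dyMesh_antitone : Antitone dyMesh := by
  intro m n hmn
  unfold dyMesh
  exact inv_anti₀ (by positivity) (pow_le_pow_right₀ (by norm_num) hmn)

/-- `dyMesh (m + n) = dyMesh m * dyMesh n`. [folklore] -/
theorem dyMesh_add (m n : ℕ) : dyMesh (m + n) = dyMesh m * dyMesh n := by
  unfold dyMesh; rw [pow_add, mul_inv]

/-- `dyMesh n → 0`. [folklore] -/
theorem tendsto_dyMesh : Tendsto dyMesh atTop (𝓝 0) := by
  unfold dyMesh
  simp_rw [← inv_pow]
  exact tendsto_pow_atTop_nhds_zero_of_lt_one (by norm_num) (by norm_num)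

/-- There is a level with `2 · 2⁻ⁿ ≤ δ`. [folklore] -/
theorem exists_two_mul_dyMesh_le {δ : ℝ} (hδ : 0 < δ) : ∃ n, 2 * dyMesh n ≤ δ := by
  have h := (tendsto_dyMesh.const_mul 2).eventually (ge_mem_nhds (show (2 : ℝ) * 0 < δ by simpa))
  exact h.exists

/-- A real number is within `2⁻ⁿ` of its level-`n` grid coordinate `⌊x 2ⁿ⌋ 2⁻ⁿ`. [folklore] -/
theorem abs_sub_floor_mul_dyMesh_lt (x : ℝ) (n : ℕ) :
    |x - ⌊x * 2 ^ n⌋ * dyMesh n| < dyMesh n := by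
  have h2 : (0 : ℝ) < 2 ^ n := by positivity
  have hm := dyMesh_pos n
  have hx : x = x * 2 ^ n * dyMesh n := by rw [mul_assoc, two_pow_mul_dyMesh, mul_one]
  rw [abs_lt]
  constructor
  · have := Int.floor_le (x * 2 ^ n)
    nlinarith
  · have := Int.lt_floor_add_one (x * 2 ^ n)
    nlinarith

/-- **The grid discs cover the rectangle**: every point of `[x₁, x₂] × [y₁, y₂]` is within `2 · 2⁻ⁿ`
of the grid point indexed by `(⌊re · 2ⁿ⌋, ⌊im · 2ⁿ⌋) ∈ dyBox`. [folklore] -/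
theorem exists_dist_dyPt_lt {x₁ x₂ y₁ y₂ : ℝ} (n : ℕ) {w : ℂ} (hw : w ∈ Icc x₁ x₂ ×ℂ Icc y₁ y₂) :
    ∃ p ∈ dyBox x₁ x₂ y₁ y₂ n, dist w (dyPt n p) < 2 * dyMesh n := by
  obtain ⟨⟨hx₁, hx₂⟩, ⟨hy₁, hy₂⟩⟩ := hw
  refine ⟨(⌊w.re * 2 ^ n⌋, ⌊w.im * 2 ^ n⌋), ?_, ?_⟩
  · have h2 : (0 : ℝ) ≤ 2 ^ n := by positivity
    simp only [dyBox, Finset.mem_product, Finset.mem_Icc]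
    refine ⟨⟨?_, ?_⟩, ⟨?_, ?_⟩⟩
    · linarith [Int.floor_mono (mul_le_mul_of_nonneg_right hx₁ h2)]
    · linarith [Int.floor_mono (mul_le_mul_of_nonneg_right hx₂ h2), Int.floor_le_ceil (x₂ * 2 ^ n)]
    · linarith [Int.floor_mono (mul_le_mul_of_nonneg_right hy₁ h2)]
    · linarith [Int.floor_mono (mul_le_mul_of_nonneg_right hy₂ h2), Int.floor_le_ceil (y₂ * 2 ^ n)]
  · rw [dist_eq_norm]
    refine (norm_le_abs_re_add_abs_im _).trans_lt ?_
    have h1 := abs_sub_floor_mul_dyMesh_lt w.re n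
    have h2 := abs_sub_floor_mul_dyMesh_lt w.im n
    simp only [dyPt, sub_re, sub_im] at *
    linarith

/-- Grid points of `dyBox` lie in the `δ`-enlarged rectangle once `2 · 2⁻ⁿ ≤ δ`. [folklore] -/
theorem dyPt_mem_of_mem_dyBox {x₁ x₂ y₁ y₂ δ : ℝ} {n : ℕ} (hn : 2 * dyMesh n ≤ δ) {p : ℤ × ℤ}
    (hp : p ∈ dyBox x₁ x₂ y₁ y₂ n) :
    dyPt n p ∈ Icc (x₁ - δ) (x₂ + δ) ×ℂ Icc (y₁ - δ) (y₂ + δ) := by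
  simp only [dyBox, Finset.mem_product, Finset.mem_Icc] at hp
  obtain ⟨⟨h1, h2⟩, ⟨h3, h4⟩⟩ := hp
  have hm := dyMesh_pos n
  have hid : ∀ x : ℝ, x = x * 2 ^ n * dyMesh n := fun x ↦ by
    rw [mul_assoc, two_pow_mul_dyMesh, mul_one]
  -- cast the integer bounds
  have h1' : ((⌊x₁ * 2 ^ n⌋ : ℤ) : ℝ) - 1 ≤ p.1 := by exact_mod_cast h1
  have h2' : (p.1 : ℝ) ≤ (⌈x₂ * 2 ^ n⌉ : ℤ) + 1 := by exact_mod_cast h2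
  have h3' : ((⌊y₁ * 2 ^ n⌋ : ℤ) : ℝ) - 1 ≤ p.2 := by exact_mod_cast h3
  have h4' : (p.2 : ℝ) ≤ (⌈y₂ * 2 ^ n⌉ : ℤ) + 1 := by exact_mod_cast h4
  have hf1 := Int.lt_floor_add_one (x₁ * 2 ^ n)
  have hc2 := Int.ceil_lt_add_one (x₂ * 2 ^ n)
  have hf3 := Int.lt_floor_add_one (y₁ * 2 ^ n)
  have hc4 := Int.ceil_lt_add_one (y₂ * 2 ^ n)
  simp only [mem_reProdIm, dyPt, mem_Icc]
  refine ⟨⟨?_, ?_⟩, ⟨?_, ?_⟩⟩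
  · have : (x₁ * 2 ^ n - 2) * dyMesh n ≤ p.1 * dyMesh n :=
      mul_le_mul_of_nonneg_right (by linarith) hm.le
    rw [sub_mul, ← hid] at this
    linarith
  · have : (p.1 : ℝ) * dyMesh n ≤ (x₂ * 2 ^ n + 2) * dyMesh n :=
      mul_le_mul_of_nonneg_right (by linarith) hm.le
    rw [add_mul, ← hid] at this
    linarith
  · have : (y₁ * 2 ^ n - 2) * dyMesh n ≤ p.2 * dyMesh n :=
      mul_le_mul_of_nonneg_right (by linarith) hm.le
    rw [sub_mul, ← hid] at this
    linarith
  · have : (p.2 : ℝ) * dyMesh n ≤ (y₂ * 2 ^ n + 2) * dyMesh n :=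
      mul_le_mul_of_nonneg_right (by linarith) hm.le
    rw [add_mul, ← hid] at this
    linarith

/-- Cardinality of an integer interval `[⌊u⌋ - 1, ⌈v⌉ + 1]`, `u ≤ v`: at most `v - u + 5`.
[folklore] -/
theorem card_Icc_floor_ceil_le {u v : ℝ} (huv : u ≤ v) :
    ((Finset.Icc (⌊u⌋ - 1) (⌈v⌉ + 1)).card : ℝ) ≤ v - u + 5 := by
  have hle : ⌊u⌋ - 1 ≤ ⌈v⌉ + 1 + 1 := by
    have : ⌊u⌋ ≤ ⌈v⌉ := (Int.floor_mono huv).trans (Int.floor_le_ceil v)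
    linarith
  have h := Int.card_Icc_of_le _ _ hle
  have h' : ((Finset.Icc (⌊u⌋ - 1) (⌈v⌉ + 1)).card : ℝ) = ((⌈v⌉ : ℤ) : ℝ) + 1 + 1 - ((⌊u⌋ : ℤ) - 1) := by
    have := congrArg (fun z : ℤ ↦ (z : ℝ)) h
    push_cast at this ⊢
    exact this
  rw [h']
  have hf := Int.lt_floor_add_one u
  have hc := Int.ceil_lt_add_one v
  linarith

/-- **The grid has `O(4ⁿ)` points**: `#dyBox ≤ ((x₂ - x₁) + 5)((y₂ - y₁) + 5) 4ⁿ`. [folklore] -/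
theorem card_dyBox_le {x₁ x₂ y₁ y₂ : ℝ} (hx : x₁ ≤ x₂) (hy : y₁ ≤ y₂) (n : ℕ) :
    ((dyBox x₁ x₂ y₁ y₂ n).card : ℝ) ≤ ((x₂ - x₁) + 5) * ((y₂ - y₁) + 5) * 4 ^ n := by
  have h2 : (1 : ℝ) ≤ 2 ^ n := one_le_pow₀ (by norm_num)
  have h2' : (0 : ℝ) ≤ 2 ^ n := by positivity
  rw [dyBox, Finset.card_product, Nat.cast_mul]
  have ha := card_Icc_floor_ceil_le (mul_le_mul_of_nonneg_right hx h2')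
  have hb := card_Icc_floor_ceil_le (mul_le_mul_of_nonneg_right hy h2')
  have h4 : (4 : ℝ) ^ n = 2 ^ n * 2 ^ n := by rw [← mul_pow]; norm_num
  calc ((Finset.Icc (⌊x₁ * 2 ^ n⌋ - 1) (⌈x₂ * 2 ^ n⌉ + 1)).card : ℝ) *
        ((Finset.Icc (⌊y₁ * 2 ^ n⌋ - 1) (⌈y₂ * 2 ^ n⌉ + 1)).card : ℝ)
      ≤ (x₂ * 2 ^ n - x₁ * 2 ^ n + 5) * (y₂ * 2 ^ n - y₁ * 2 ^ n + 5) :=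
        mul_le_mul ha hb (Nat.cast_nonneg _) (by nlinarith)
    _ ≤ ((x₂ - x₁ + 5) * 2 ^ n) * ((y₂ - y₁ + 5) * 2 ^ n) := by
        apply mul_le_mul <;> nlinarith
    _ = ((x₂ - x₁) + 5) * ((y₂ - y₁) + 5) * 4 ^ n := by rw [h4]; ring

end Grid

/-! ### The first-moment bound -/

section FirstMoment

variable {Ω : Type*} [MeasurableSpace Ω] {μ : Measure Ω} {Γ : Ω → Set ℂ}

/-- The diameter of a metric disc of radius `ρ ≥ 0` is at most `2ρ` (in `ℝ≥0∞`). [folklore] -/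
theorem ediam_ball_le_ofReal {X : Type*} [PseudoMetricSpace X] (x : X) (ρ : ℝ) :
    ediam (ball x ρ) ≤ ENNReal.ofReal (2 * ρ) := by
  rw [← Metric.eball_ofReal, ENNReal.ofReal_mul zero_le_two, ENNReal.ofReal_ofNat]
  exact Metric.ediam_eball_le

/-- **First-moment covering bound.** Let `Γ(ω) ⊆ ℂ` be a random set and `A = [x₁,x₂] × [y₁,y₂]`.
If for some `δ > 0`, `C ≥ 0` and an exponent `a` every point `z` of the `δ`-enlarged rectangle satisfies
`μ {ω | dist(z, Γ ω) ≤ ε} ≤ C ε^a` for all `0 < ε ≤ δ` (outer measure; no measurability assumed),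
then for every `d > 0` with `a + d > 2`, almost surely `μH[d] (Γ ω ∩ A) = 0`. The covering step of
Rohde–Schramm (2005), Thm 8.1 ⇒ Cor 8.2 (p. 914), as an SLE-free lemma; cf. Lawler (2005),
Lemma A.1. [cite: RohdeSchramm2005, Cor 8.2 (proof)] -/
theorem ae_hausdorffMeasure_inter_reProdIm_eq_zero {x₁ x₂ y₁ y₂ δ C a d : ℝ} (hx : x₁ ≤ x₂)
    (hy : y₁ ≤ y₂) (hδ : 0 < δ) (hC : 0 ≤ C) (hd : 0 < d) (had : 2 < a + d)
    (hP : ∀ z ∈ Icc (x₁ - δ) (x₂ + δ) ×ℂ Icc (y₁ - δ) (y₂ + δ), ∀ ε : ℝ, 0 < ε → ε ≤ δ →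
      μ {ω | infDist z (Γ ω) ≤ ε} ≤ ENNReal.ofReal (C * ε ^ a)) :
    ∀ᵐ ω ∂μ, μH[d] (Γ ω ∩ (Icc x₁ x₂ ×ℂ Icc y₁ y₂)) = 0 := by
  classical
  obtain ⟨n₀, hn₀⟩ := exists_two_mul_dyMesh_le hδ
  -- level `m` uses the grid of mesh `2^{-(m+n₀)}`
  set lv : ℕ → ℕ := fun m ↦ m + n₀ with hlv
  have hlvδ : ∀ m, 2 * dyMesh (lv m) ≤ δ := fun m ↦
    (mul_le_mul_of_nonneg_left (dyMesh_antitone (Nat.le_add_left n₀ m)) zero_le_two).trans hn₀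
  set box : ℕ → Finset (ℤ × ℤ) := fun m ↦ dyBox x₁ x₂ y₁ y₂ (lv m) with hbox
  -- the events and their measurable hulls
  set E : ℕ → ℤ × ℤ → Set Ω := fun m p ↦ {ω | infDist (dyPt (lv m) p) (Γ ω) ≤ 2 * dyMesh (lv m)}
    with hE
  set F : ℕ → ℤ × ℤ → Set Ω := fun m p ↦ toMeasurable μ (E m p) with hF
  have hFm : ∀ m p, MeasurableSet (F m p) := fun m p ↦ measurableSet_toMeasurable _ _
  have hEF : ∀ m p, E m p ⊆ F m p := fun m p ↦ subset_toMeasurable _ _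
  -- the counting variables `N m = Σ_{p ∈ box m} 𝟙_{F m p}` and the weights `w m = (4 · mesh)^d`
  set N : ℕ → Ω → ℝ≥0∞ := fun m ω ↦ ∑ p ∈ box m, (F m p).indicator 1 ω with hN
  have hNm : ∀ m, Measurable (N m) := fun m ↦
    Finset.measurable_sum _ fun p _ ↦ measurable_one.indicator (hFm m p)
  set w : ℕ → ℝ≥0∞ := fun m ↦ ENNReal.ofReal ((4 * dyMesh (lv m)) ^ d) with hw
  -- (1) `E[N m] ≤ #box · C (2 mesh)^a`
  have hEN : ∀ m, ∫⁻ ω, N m ω ∂μ ≤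
      (box m).card * ENNReal.ofReal (C * (2 * dyMesh (lv m)) ^ a) := by
    intro m
    have hsum : ∫⁻ ω, N m ω ∂μ = ∑ p ∈ box m, μ (E m p) := by
      rw [hN, lintegral_finsetSum _ fun p _ ↦ measurable_one.indicator (hFm m p)]
      refine Finset.sum_congr rfl fun p _ ↦ ?_
      rw [lintegral_indicator_one (hFm m p), hF, measure_toMeasurable]
    rw [hsum]
    have hle : ∀ p ∈ box m, μ (E m p) ≤ ENNReal.ofReal (C * (2 * dyMesh (lv m)) ^ a) := fun p hp ↦
      hP _ (dyPt_mem_of_mem_dyBox (hlvδ m) hp) _ (by linarith [dyMesh_pos (lv m)]) (hlvδ m)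
    calc ∑ p ∈ box m, μ (E m p) ≤ ∑ p ∈ box m, ENNReal.ofReal (C * (2 * dyMesh (lv m)) ^ a) :=
          Finset.sum_le_sum hle
      _ = _ := by rw [Finset.sum_const, nsmul_eq_mul]
  -- (2) the series `Σ_m w m · E[N m]` converges (geometric with ratio `2^{2-a-d} < 1`)
  set ρ : ℝ := (2 : ℝ) ^ (2 - a - d) with hρ
  have hρ0 : 0 ≤ ρ := by positivity
  have hρ1 : ρ < 1 := Real.rpow_lt_one_of_one_lt_of_neg (by norm_num) (by linarith)
  set K : ℝ := 4 ^ d * (((x₂ - x₁) + 5) * ((y₂ - y₁) + 5)) * (C * 2 ^ a) * ρ ^ n₀ with hK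
  have hK0 : 0 ≤ K := by
    have : 0 ≤ ((x₂ - x₁) + 5) * ((y₂ - y₁) + 5) := by nlinarith
    positivity
  have hterm : ∀ m, w m * ∫⁻ ω, N m ω ∂μ ≤ ENNReal.ofReal K * ENNReal.ofReal ρ ^ m := by
    intro m
    have hmesh := dyMesh_pos (lv m)
    set s : ℝ := dyMesh (lv m) with hs
    -- `s = 2^{-(m+n₀)}`, so `s^{2-a-d}·... ` : we use `4^{lv m} s^{a+d} = ρ^{lv m}`
    have hcard := card_dyBox_le hx hy (lv m) (x₁ := x₁) (y₁ := y₁)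
    have h1 : w m * ∫⁻ ω, N m ω ∂μ ≤ ENNReal.ofReal ((4 * s) ^ d) *
        ((box m).card * ENNReal.ofReal (C * (2 * s) ^ a)) := mul_le_mul_right (hEN m) _
    refine h1.trans ?_
    -- everything is a non-negative real now
    have hcardR : ((box m).card : ℝ≥0∞) = ENNReal.ofReal ((box m).card : ℝ) := by
      rw [ENNReal.ofReal_natCast]
    rw [hcardR, ← ENNReal.ofReal_mul (by positivity), ← ENNReal.ofReal_mul (by positivity),
      ← ENNReal.ofReal_pow hρ0, ← ENNReal.ofReal_mul hK0]
    refine ENNReal.ofReal_le_ofReal ?_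
    -- the real inequality `(4s)^d · #box · C (2s)^a ≤ K ρ^m`
    have hsd : (4 * s) ^ d = 4 ^ d * s ^ d := Real.mul_rpow (by norm_num) hmesh.le
    have hsa : (2 * s) ^ a = 2 ^ a * s ^ a := Real.mul_rpow (by norm_num) hmesh.le
    have hpow : (4 : ℝ) ^ (lv m) * (s ^ d * s ^ a) = ρ ^ (lv m) := by
      have h2 : (0 : ℝ) < 2 := two_pos
      have hs2 : s = (2 : ℝ) ^ (-(lv m : ℝ)) := by
        rw [hs, dyMesh, Real.rpow_neg h2.le, Real.rpow_natCast]
      have h4 : (4 : ℝ) ^ (lv m) = (2 : ℝ) ^ (2 * (lv m : ℝ)) := by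
        rw [Real.rpow_mul h2.le, Real.rpow_two, show (2 : ℝ) ^ 2 = 4 by norm_num, Real.rpow_natCast]
      rw [hs2, h4, ← Real.rpow_mul h2.le, ← Real.rpow_mul h2.le, ← Real.rpow_add h2,
        ← Real.rpow_add h2, hρ, ← Real.rpow_natCast, ← Real.rpow_mul h2.le]
      congr 1
      ring
    have hρm : ρ ^ (lv m) = ρ ^ n₀ * ρ ^ m := by rw [hlv]; simp only; rw [pow_add, mul_comm]
    have hbd : 0 ≤ C * (2 ^ a * s ^ a) := by positivity
    calc (4 * s) ^ d * (((box m).card : ℝ) * (C * (2 * s) ^ a))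
        = (4 ^ d * s ^ d) * ((box m).card : ℝ) * (C * (2 ^ a * s ^ a)) := by rw [hsd, hsa]; ring
      _ ≤ (4 ^ d * s ^ d) * (((x₂ - x₁) + 5) * ((y₂ - y₁) + 5) * 4 ^ (lv m)) * (C * (2 ^ a * s ^ a)) := by
          gcongr
      _ = 4 ^ d * (((x₂ - x₁) + 5) * ((y₂ - y₁) + 5)) * (C * 2 ^ a) * (4 ^ (lv m) * (s ^ d * s ^ a)) := by
          ring
      _ = K * ρ ^ m := by rw [hpow, hρm, hK]; ring
  have hsum_lt : ∑' m, w m * ∫⁻ ω, N m ω ∂μ ≠ ∞ := by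
    refine ne_top_of_le_ne_top ?_ (ENNReal.tsum_le_tsum hterm)
    rw [ENNReal.tsum_mul_left, ENNReal.tsum_geometric]
    refine ENNReal.mul_ne_top ENNReal.ofReal_ne_top (ENNReal.inv_ne_top.2 ?_)
    exact (tsub_pos_iff_lt.2 (ENNReal.ofReal_lt_one.2 hρ1)).ne'
  -- (3) hence a.s. `Σ_m w m N m < ∞`, so `w m N m → 0`
  have hint : ∫⁻ ω, ∑' m, w m * N m ω ∂μ ≠ ∞ := by
    rw [lintegral_tsum fun m ↦ ((hNm m).const_mul (w m)).aemeasurable]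
    simp_rw [lintegral_const_mul _ (hNm _)]
    exact hsum_lt
  have hae : ∀ᵐ ω ∂μ, ∑' m, w m * N m ω < ∞ :=
    ae_lt_top (Measurable.tsum fun m ↦ (hNm m).const_mul (w m)) hint
  filter_upwards [hae] with ω hω
  have htend : Tendsto (fun m ↦ w m * N m ω) atTop (𝓝 0) :=
    ENNReal.tendsto_atTop_zero_of_tsum_ne_top hω.ne
  -- (4) the covering bound `μH[d](Γ ω ∩ A) ≤ liminf_m Σ_p ediam(t m p)^d ≤ liminf_m w m N m ω = 0`
  set A : Set ℂ := Icc x₁ x₂ ×ℂ Icc y₁ y₂ with hA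
  set t : ∀ m : ℕ, ↥(box m) → Set ℂ := fun m p ↦
    if ω ∈ E m p then ball (dyPt (lv m) p) (2 * dyMesh (lv m)) else ∅ with ht
  set r : ℕ → ℝ≥0∞ := fun m ↦ ENNReal.ofReal (4 * dyMesh (lv m)) with hr
  have hr0 : Tendsto r atTop (𝓝 0) := by
    rw [hr, ← ENNReal.ofReal_zero]
    refine ENNReal.tendsto_ofReal ?_
    have := (tendsto_dyMesh.comp (tendsto_add_atTop_nat n₀)).const_mul 4
    rw [mul_zero] at this
    exact this
  have hdiam : ∀ m (p : ↥(box m)), ediam (t m p) ≤ r m := by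
    intro m p
    simp only [ht]
    split_ifs
    · refine (ediam_ball_le_ofReal _ _).trans (le_of_eq ?_)
      rw [hr]; ring_nf
    · simp
  have hcover : ∀ m, Γ ω ∩ A ⊆ ⋃ p : ↥(box m), t m p := by
    intro m v ⟨hvΓ, hvA⟩
    obtain ⟨p, hp, hdist⟩ := exists_dist_dyPt_lt (lv m) hvA
    refine mem_iUnion.2 ⟨⟨p, hp⟩, ?_⟩
    have hωE : ω ∈ E m p := by
      simp only [hE, mem_setOf_eq]
      refine (infDist_le_dist_of_mem hvΓ).trans ?_
      rw [dist_comm]; exact hdist.le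
    simp only [ht, hωE, if_true]
    exact mem_ball.2 hdist
  have hH := hausdorffMeasure_le_liminf_sum d (Γ ω ∩ A) r hr0 t (Eventually.of_forall hdiam)
    (Eventually.of_forall hcover)
  -- compare the sums with `w m * N m ω`
  have hsum_le : ∀ m, ∑ p : ↥(box m), ediam (t m p) ^ d ≤ w m * N m ω := by
    intro m
    have hterm' : ∀ p : ↥(box m), ediam (t m p) ^ d ≤ w m * (F m p).indicator 1 ω := by
      intro p
      by_cases hωE : ω ∈ E m p
      · have hωF : ω ∈ F m p := hEF m p hωE
        rw [indicator_of_mem hωF, Pi.one_apply, mul_one]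
        calc ediam (t m p) ^ d ≤ r m ^ d := ENNReal.rpow_le_rpow (hdiam m p) hd.le
          _ = w m := by
              rw [hr, hw]
              exact ENNReal.ofReal_rpow_of_nonneg (by linarith [dyMesh_pos (lv m)]) hd.le
      · simp only [ht, hωE, if_false, Metric.ediam_empty, ENNReal.zero_rpow_of_pos hd]
        exact zero_le
    calc ∑ p : ↥(box m), ediam (t m p) ^ d ≤ ∑ p : ↥(box m), w m * (F m p).indicator 1 ω :=
          Finset.sum_le_sum fun p _ ↦ hterm' p
      _ = w m * N m ω := by
          rw [← Finset.mul_sum, hN]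
          congr 1
          exact Finset.sum_coe_sort (box m) (fun p ↦ (F m p).indicator 1 ω)
  have hlim : liminf (fun m ↦ ∑ p : ↥(box m), ediam (t m p) ^ d) atTop ≤ 0 := by
    calc liminf (fun m ↦ ∑ p : ↥(box m), ediam (t m p) ^ d) atTop
        ≤ liminf (fun m ↦ w m * N m ω) atTop := liminf_le_liminf (Eventually.of_forall hsum_le)
      _ = 0 := htend.liminf_eq
  exact le_antisymm (hH.trans hlim) zero_le

/-- **From `μH[d] = 0` for all `d > d₀` to `dim_H ≤ d₀`, almost surely**: if for every `d > d₀`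
almost surely `μH[d] (S ω) = 0`, then almost surely `dim_H (S ω) ≤ d₀` (countably many
`d = d₀ + 1/(k+1)` suffice). [folklore] -/
theorem ae_dimH_le_of_forall_lt {X : Type*} [EMetricSpace X] [MeasurableSpace X] [BorelSpace X]
    {S : Ω → Set X} {d₀ : ℝ≥0} (h : ∀ d : ℝ≥0, d₀ < d → ∀ᵐ ω ∂μ, μH[d] (S ω) = 0) :
    ∀ᵐ ω ∂μ, dimH (S ω) ≤ d₀ := by
  have hk : ∀ k : ℕ, ∀ᵐ ω ∂μ, μH[(d₀ + 1 / ((k : ℝ≥0) + 1) : ℝ≥0)] (S ω) = 0 := fun k ↦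
    h _ (lt_add_of_pos_right _ (by positivity))
  rw [← ae_all_iff] at hk
  filter_upwards [hk] with ω hω
  refine ENNReal.le_of_forall_pos_le_add fun ε hε _ ↦ ?_
  obtain ⟨k, hk⟩ := exists_nat_one_div_lt hε
  have hle : dimH (S ω) ≤ (d₀ + 1 / ((k : ℝ≥0) + 1) : ℝ≥0) :=
    dimH_le_of_hausdorffMeasure_ne_top (by rw [hω k]; exact ENNReal.zero_ne_top)
  refine hle.trans ?_
  have hk' : (1 / ((k : ℝ≥0) + 1) : ℝ≥0) ≤ ε := by
    rw [← NNReal.coe_le_coe]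
    push_cast
    exact hk.le
  calc (((d₀ + 1 / ((k : ℝ≥0) + 1) : ℝ≥0)) : ℝ≥0∞) = (d₀ : ℝ≥0∞) + ((1 / ((k : ℝ≥0) + 1) : ℝ≥0) : ℝ≥0∞) := by
        push_cast; rfl
    _ ≤ d₀ + ε := by gcongr

/-- **First-moment dimension bound.** Under the one-point estimate of
`ae_hausdorffMeasure_inter_reProdIm_eq_zero` with exponent `a ≤ 2`, almost surely
`dim_H (Γ ω ∩ [x₁,x₂]×[y₁,y₂]) ≤ 2 - a`. [cite: RohdeSchramm2005, Cor 8.2 (proof)] -/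
theorem ae_dimH_inter_reProdIm_le {x₁ x₂ y₁ y₂ δ C : ℝ} {a : ℝ≥0} (hx : x₁ ≤ x₂) (hy : y₁ ≤ y₂)
    (hδ : 0 < δ) (hC : 0 ≤ C) (ha2 : a ≤ 2)
    (hP : ∀ z ∈ Icc (x₁ - δ) (x₂ + δ) ×ℂ Icc (y₁ - δ) (y₂ + δ), ∀ ε : ℝ, 0 < ε → ε ≤ δ →
      μ {ω | infDist z (Γ ω) ≤ ε} ≤ ENNReal.ofReal (C * ε ^ (a : ℝ))) :
    ∀ᵐ ω ∂μ, dimH (Γ ω ∩ (Icc x₁ x₂ ×ℂ Icc y₁ y₂)) ≤ (2 - a : ℝ≥0) := by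
  refine ae_dimH_le_of_forall_lt fun d hd ↦ ?_
  have hd' : (2 : ℝ) - a < d := by
    have h := NNReal.coe_lt_coe.2 hd
    rwa [NNReal.coe_sub ha2] at h
  exact ae_hausdorffMeasure_inter_reProdIm_eq_zero hx hy hδ hC
    (by linarith [a.coe_nonneg, (show (a : ℝ) ≤ 2 from ha2)]) (by linarith) hP

end FirstMoment

end Literature.MeasureTheory.Hausdorff
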